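import Summits.CriticalPhenomena.SAWScalingLimit.Theses.SAWCompassLattice

/-!
# Port transfer, part A: the compass law as a push-forward, and the port dictionary

Helper file of the line `Sketch` for the crux `HexTransfer` (stmt-CriticalPhenomena-14221), stub
`stub_portTransfer : PortDictionary → YBSquareSLE → CompassSLE`.

The route's items `SAWCompassLattice.{CompassSLE, PortDictionary, SurfaceUniversality}` are typed
with one long common `let`-prefix (the compass graph `G = SimpleGraph.fromRel R` on
`MidEdge ⊕ Face × Fin 3 × Fin 4`, the edge fugacity `y`, the path weight `wt`, the embedding
`emb`, the vertex restriction `S Ω δ`, the curve-level measure `μ` and its normalisation `law`).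
This file writes these `let`-bound objects as honest definitions (`compassGraph`, `compassY`,
`compassWt`, `compassEmb`, `compassS`, `CPath`, `compassCurve`, `compassMu`, `compassLaw`) —
they are *syntactically* the bodies of the `let`s, so the items unfold to statements about them
by `rfl` (zeta reduction) — and proves the measure-theoretic half of the port transfer:

* `compassWt_pos` — compass paths have positive weight (all fugacities are positive and the
  graph has no port–port edge);
* `exists_mids_eq`, `toYB` — under `PortDictionary`, every compass path `p` of `Ω_δ` has a
  (unique) Yang–Baxter walk `toYB p` of `meshFaces (π/2) Ω δ` crossing the same ports in the same
  order (`mids = ports p`): its fibre has positive compass weight, hence positive GM weight;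
* `map_toYB` — **pushing the compass path measure `ρ₀ = Σ_p wt(p) δ_p` forward along `toYB` gives
  GM's measure `ybWeight (π/2) Ω δ 1 a b = Σ_γ w_{π/2}(γ) δ_γ`** (regroup the sum over the fibres
  of `toYB` and apply the dictionary fibrewise); consequently the two partition functions agree
  (`ybWeight_univ_eq`), the compass law on curves is the push-forward of the normalised path
  measure `compassRho` along the drawing map (`compassLaw_eq_map`), GM's law `ybLaw` is its
  push-forward along `toYB` (`ybLaw_eq_map`), and `compassRho` is either `0` or a probability
  measure (`compassRho_zero_or_prob`).

Glazman–Manolescu, arXiv:1708.00395, §1 (the Yang–Baxter walk); the compass gadget is the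
route's own construction (idea card compass-lattice-integrable-saw). Tagged [folklore]
(bookkeeping) / [cite: GlazmanManolescu2019, §1].
-/

noncomputable section

namespace Summit.CriticalPhenomena.SAWScalingLimit.Cruxes.HexTransfer.Sketch.PortTransfer

open MeasureTheory Filter Topology Set
open scoped ENNReal NNReal
open Literature.Probability.RandomPlanarGeometry.SAW.YangBaxter Literature.Probability.RandomPlanarGeometry
open Summit.CriticalPhenomena.SAWScalingLimit.Theses

/-- The angle sequence of the square tiling: `Θ ≡ π/2`. -/
local notation "Θ₂" => (fun (_ : ℤ) => Real.pi / 2)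

/-! ### The `let`-bound objects of the route's items, as definitions -/

/-- The vertices of the compass lattice: ports (mid-edges of the square tiling) and, for each
face, the twelve gadget vertices `(f, l, i)`, `l ∈ Fin 3` the layer (terminal / outer / inner),
`i ∈ Fin 4` the position. [folklore] -/
abbrev CVert : Type := MidEdge ⊕ Face × Fin 3 × Fin 4

/-- The cyclic order `W, N, E, S` of the sides of a face used to attach the terminals to the
ports (the `let cyc` of the items). [folklore] -/
def compassCyc : Fin 4 → Side := ![Side.W, Side.N, Side.E, Side.S]

/-- **The compass graph** `Γ*` (the `let G := SimpleGraph.fromRel R` of the items): terminal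
`(f, 0, i)` — port on side `cyc i` of `f`; outer 8-cycle terminals/`A`-vertices
`(f, 0, i) — (f, 1, i), (f, 1, i-1)`; spokes `(f, 1, i) — (f, 2, i)`; inner 4-cycle
`(f, 2, i) — (f, 2, i+1)`. [folklore] -/
def compassGraph : SimpleGraph CVert :=
  SimpleGraph.fromRel fun x x' => (match x, x' with
    | Sum.inl e, Sum.inr (f, (l, i)) => l = 0 ∧ f.side (compassCyc i) = e
    | Sum.inr (f, (l, i)), Sum.inr (f', (l', i')) => f = f' ∧ ((l = 0 ∧ l' = 1 ∧ (i' = i ∨ i' + 1 =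
      i)) ∨ (l = 1 ∧ l' = 2 ∧ i' = i) ∨ (l = 2 ∧ l' = 2 ∧ i' = i + 1))
    | _, _ => False)

/-- **The edge fugacities** (the `let y` of the items): `z` on port–terminal edges, `α` on the
outer cycle, `s` on the spokes, `β` on the inner cycle (`0` on non-edges). [folklore] -/
def compassY (α β s z : ℝ) : CVert → CVert → ℝ := fun x x' => (match x, x' with
  | Sum.inl _, Sum.inr _ => z
  | Sum.inr _, Sum.inl _ => z
  | Sum.inr (_, (l, _)), Sum.inr (_, (l', _)) =>
      if l = 0 ∨ l' = 0 then α else if l = 1 ∨ l' = 1 then s else β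
  | _, _ => 0)

/-- **The weight of a compass path**: the product of the fugacities of its edges (the `let wt`
of the items). [folklore] -/
def compassWt (α β s z : ℝ) {u v : CVert} (p : compassGraph.Walk u v) : ℝ :=
  (p.darts.map fun d => compassY α β s z d.fst d.snd).prod

/-- The four unit directions `W, N, E, S ↦ -1, i, 1, -i` (the `let dir` of the items).
[folklore] -/
def compassDir : Fin 4 → ℂ := ![-1, Complex.I, 1, -Complex.I]

/-- **The planar embedding of the compass lattice** at mesh `1` (the `let emb` of the items):
ports at the midpoints of the sides, gadget vertices near the centre of their face. [folklore] -/
def compassEmb : CVert → ℂ := fun x => (match x with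
  | Sum.inl e => planeMidpoint (fun (_ : ℤ) => Real.pi / 2) e
  | Sum.inr (f, (l, i)) => planeCorner (fun (_ : ℤ) => Real.pi / 2) f + (1 + Complex.I) / 2 +
      (if l = 0 then (3 / 8 : ℂ) * compassDir i
        else (if l = 1 then (1 / 4 : ℂ) else (1 / 8 : ℂ)) * (compassDir i + compassDir (i + 1))))

/-- The vertices allowed at mesh `δ` in the domain `Ω` (the `let S` of the items): gadget
vertices only of faces of `meshFaces (π/2) Ω δ` (ports unrestricted). [folklore] -/
def compassS (Ω : Set ℂ) (δ : ℝ) : Set CVert :=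
  {v | ∀ f q, v = Sum.inr (f, q) → f ∈ meshFaces (fun (_ : ℤ) => Real.pi / 2) Ω δ}

/-- **The compass self-avoiding paths of `Ω_δ` from port `a` to port `b`** (the index type of the
`Measure.sum` in the `let μ` of the items), with the discrete σ-algebra. [folklore] -/
def CPath (Ω : Set ℂ) (δ : ℝ) (a b : MidEdge) : Type :=
  {p : compassGraph.Walk (Sum.inl a) (Sum.inl b) // p.IsPath ∧ ∀ v ∈ p.support, v ∈ compassS Ω δ}

/-- Discrete σ-algebra on the compass paths. [folklore] -/
instance instMeasurableSpaceCPath (Ω : Set ℂ) (δ : ℝ) (a b : MidEdge) :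
    MeasurableSpace (CPath Ω δ a b) := ⊤

/-- Every map out of the compass paths is measurable (discrete σ-algebra). [folklore] -/
theorem measurable_cpath {Ω : Set ℂ} {δ : ℝ} {a b : MidEdge} {β : Type*} [MeasurableSpace β]
    (f : CPath Ω δ a b → β) : Measurable f :=
  fun _ _ => MeasurableSpace.measurableSet_top

/-- **The compass path drawn at mesh `δ`**, modulo reparametrisation: the polyline through the
rescaled embedded vertices (the Dirac point in the `let μ` of the items). [folklore] -/
def compassCurve {Ω : Set ℂ} {δ : ℝ} {a b : MidEdge} (δ' : ℝ) (p : CPath Ω δ a b) :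
    CurveClass ℂ :=
  CurveClass.mk ⟨p.1.toCurve fun v => (δ' : ℂ) * compassEmb v⟩

/-- **The compass measure on curve classes** (the `let μ` of the items):
`Σ_p wt(p) · δ_{curve of p}`. [folklore] -/
def compassMu (α β s z : ℝ) (Ω : Set ℂ) (δ : ℝ) (a b : MidEdge) : Measure (CurveClass ℂ) :=
  Measure.sum (fun p : CPath Ω δ a b =>
    ENNReal.ofReal (compassWt α β s z p.1) • Measure.dirac (compassCurve δ p))

/-- **The compass chordal law** (the `let law` of the items): `μ` normalised by its total mass
(junk `0` if the mass is `0` or `∞`). [folklore] -/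
def compassLaw (α β s z : ℝ) (Ω : Set ℂ) (δ : ℝ) (a b : MidEdge) : Measure (CurveClass ℂ) :=
  (compassMu α β s z Ω δ a b Set.univ)⁻¹ • compassMu α β s z Ω δ a b

/-- The compass measure on PATHS: `ρ₀ = Σ_p wt(p) · δ_p`. [folklore] -/
def compassRho0 (α β s z : ℝ) (Ω : Set ℂ) (δ : ℝ) (a b : MidEdge) : Measure (CPath Ω δ a b) :=
  Measure.sum fun p => ENNReal.ofReal (compassWt α β s z p.1) • Measure.dirac p

/-- The normalised compass measure on paths (junk `0` if the mass is `0` or `∞`). [folklore] -/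
def compassRho (α β s z : ℝ) (Ω : Set ℂ) (δ : ℝ) (a b : MidEdge) : Measure (CPath Ω δ a b) :=
  (compassRho0 α β s z Ω δ a b Set.univ)⁻¹ • compassRho0 α β s z Ω δ a b

/-- The ordered list of ports visited by a compass walk. [folklore] -/
def ports {u v : CVert} (p : compassGraph.Walk u v) : List MidEdge :=
  p.support.filterMap Sum.getLeft?

/-- The fibre of the port map over `ms` among the compass paths of a face set `Δ` (the index
type on the compass side of `PortDictionary`). [folklore] -/
def CFibre (Δ : Set Face) (a b : MidEdge) (ms : List MidEdge) : Type :=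
  {p : compassGraph.Walk (Sum.inl a) (Sum.inl b) // p.IsPath ∧
    (∀ v ∈ p.support, ∀ f q, v = Sum.inr (f, q) → f ∈ Δ) ∧ p.support.filterMap Sum.getLeft? = ms}

/-! ### The compass law is a push-forward of the path measure -/

section PushForward

variable (α β s z : ℝ) (Ω : Set ℂ) (δ : ℝ) (a b : MidEdge)

/-- `μ = (ρ₀).map (drawing)`. [folklore] -/
theorem compassMu_eq_map :
    compassMu α β s z Ω δ a b = (compassRho0 α β s z Ω δ a b).map (compassCurve δ) := by
  rw [compassRho0, Measure.map_sum (measurable_cpath _).aemeasurable]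
  unfold compassMu
  congr 1
  funext p
  rw [Measure.map_smul, Measure.map_dirac' (measurable_cpath _)]

/-- The total masses of `μ` and `ρ₀` agree. [folklore] -/
theorem compassMu_univ :
    compassMu α β s z Ω δ a b Set.univ = compassRho0 α β s z Ω δ a b Set.univ := by
  rw [compassMu_eq_map, Measure.map_apply (measurable_cpath _) MeasurableSet.univ, Set.preimage_univ]

/-- **The compass law is the push-forward of the normalised path measure along the drawing
map.** [folklore] -/
theorem compassLaw_eq_map :
    compassLaw α β s z Ω δ a b = (compassRho α β s z Ω δ a b).map (compassCurve δ) := by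
  rw [compassLaw, compassRho, Measure.map_smul, ← compassMu_eq_map, compassMu_univ]

/-- The normalised path measure is `0` (junk) or a probability measure. [folklore] -/
theorem compassRho_zero_or_prob :
    compassRho α β s z Ω δ a b = 0 ∨ IsProbabilityMeasure (compassRho α β s z Ω δ a b) := by
  unfold compassRho
  by_cases h0 : compassRho0 α β s z Ω δ a b Set.univ = 0
  · left
    rw [Measure.measure_univ_eq_zero.1 h0, smul_zero]
  by_cases htop : compassRho0 α β s z Ω δ a b Set.univ = ⊤
  · left
    rw [htop, ENNReal.inv_top, zero_smul]
  · right
    exact ⟨by rw [Measure.smul_apply, smul_eq_mul, ENNReal.inv_mul_cancel h0 htop]⟩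

end PushForward

/-! ### Positivity of the weights -/

/-- The compass graph has no port–port edge. [folklore] -/
theorem not_adj_inl_inl (e e' : MidEdge) : ¬ compassGraph.Adj (Sum.inl e) (Sum.inl e') := by
  simp [compassGraph, SimpleGraph.fromRel_adj]

/-- A port is adjacent only to the terminal of its side: `inl e — inr (f, l, i)` forces `l = 0`
and `e = f.side (cyc i)`. [folklore] -/
theorem eq_side_of_adj_inl_inr {e : MidEdge} {f : Face} {l : Fin 3} {i : Fin 4}
    (h : compassGraph.Adj (Sum.inl e) (Sum.inr (f, l, i))) : l = 0 ∧ f.side (compassCyc i) = e := by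
  simpa [compassGraph, SimpleGraph.fromRel_adj] using h

/-- Adjacent gadget vertices belong to the same face. [folklore] -/
theorem fst_eq_of_adj_inr_inr {f f' : Face} {q q' : Fin 3 × Fin 4}
    (h : compassGraph.Adj (Sum.inr (f, q)) (Sum.inr (f', q'))) : f = f' := by
  obtain ⟨l, i⟩ := q
  obtain ⟨l', i'⟩ := q'
  simp only [compassGraph, SimpleGraph.fromRel_adj] at h
  rcases h.2 with h' | h'
  · exact h'.1
  · exact h'.1.symm

variable {α β s z : ℝ}

/-- Every edge of the compass graph has positive fugacity when `α, β, s, z > 0`. [folklore] -/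
theorem compassY_pos (hα : 0 < α) (hβ : 0 < β) (hs : 0 < s) (hz : 0 < z) {x x' : CVert}
    (h : compassGraph.Adj x x') : 0 < compassY α β s z x x' := by
  rcases x with e | ⟨f, l, i⟩ <;> rcases x' with e' | ⟨f', l', i'⟩
  · exact absurd h (not_adj_inl_inl e e')
  · exact hz
  · exact hz
  · simp only [compassY]
    split_ifs
    exacts [hα, hs, hβ]

/-- **Compass paths have positive weight** when `α, β, s, z > 0`. [folklore] -/
theorem compassWt_pos (hα : 0 < α) (hβ : 0 < β) (hs : 0 < s) (hz : 0 < z) {u v : CVert}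
    (p : compassGraph.Walk u v) : 0 < compassWt α β s z p := by
  unfold compassWt
  refine List.prod_pos fun x hx => ?_
  obtain ⟨d, -, rfl⟩ := List.mem_map.1 hx
  exact compassY_pos hα hβ hs hz d.adj

/-! ### The port dictionary: the Yang–Baxter walk of a compass path -/

/-- A Yang–Baxter walk is determined by its list of mid-edges: the GM side of the dictionary
has the single term `γ`. [cite: GlazmanManolescu2019, §1] -/
theorem tsum_mids_eq {Δ : Set Face} {a b : MidEdge} (γ : YBWalk Δ a b) :
    (∑' γ' : {γ' : YBWalk Δ a b // γ'.mids = γ.mids}, ENNReal.ofReal (γ'.1.weight Θ₂)) =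
      ENNReal.ofReal (γ.weight Θ₂) := by
  rw [tsum_eq_single ⟨γ, rfl⟩]
  rintro ⟨γ', h'⟩ hne
  exact absurd (Subtype.ext (YBWalk.ext h')) hne

section Dictionary

variable (hP : SAWCompassLattice.PortDictionary)
  (hsol : 0 < α ∧ 0 < β ∧ 0 < s ∧ 0 < z ∧ z ^ 2 * (α ^ 2 + α ^ 6 + s ^ 2 * (2 * α ^ 2 * β +
    2 * α ^ 2 * β ^ 2 + 2 * α ^ 2 * β ^ 3 + 2 * α ^ 4 * β + 4 * α ^ 4 * β ^ 2 + 2 * α ^ 4 * β ^ 3 +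
    2 * α ^ 6 * β + 2 * α ^ 6 * β ^ 3) + 2 * s ^ 4 * α ^ 4 * β ^ 2) = weightU1 (Real.pi / 2) ∧
    z ^ 2 * (2 * α ^ 4 + s ^ 2 * (2 * α ^ 2 * β + 4 * α ^ 2 * β ^ 2 + 2 * α ^ 2 * β ^ 3 +
    4 * α ^ 4 * β + 4 * α ^ 4 * β ^ 3 + 4 * α ^ 6 * β ^ 2) + 2 * s ^ 4 * α ^ 4 * β ^ 2) =
    weightV (Real.pi / 2) ∧ z ^ 4 * (α ^ 4 + s ^ 2 * (4 * α ^ 4 * β + 4 * α ^ 4 * β ^ 2 +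
    4 * α ^ 4 * β ^ 3) + 2 * s ^ 4 * α ^ 4 * β ^ 2) = weightW1 (Real.pi / 2))
include hP hsol

/-- **The port dictionary, de-`let`ted**: for every face set `Δ`, ports `a, b` and port list
`ms`, the compass paths of `Δ` from `a` to `b` with port sequence `ms` weigh the GM weight of the
Yang–Baxter walks of `Δ` with `mids = ms` (item stmt-CriticalPhenomena-6966, hypothesis `hP`,
unfolded by zeta reduction). [folklore] -/
theorem tsum_fibre_eq (Δ : Set Face) (a b : MidEdge) (ms : List MidEdge) :
    (∑' p : CFibre Δ a b ms, ENNReal.ofReal (compassWt α β s z p.1)) =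
      ∑' γ : {γ : YBWalk Δ a b // γ.mids = ms}, ENNReal.ofReal (γ.1.weight Θ₂) :=
  hP α β s z hsol Δ a b ms

/-- **Every compass path of `Ω_δ` has a Yang–Baxter walk of `Ω_δ` through the same ports**: its
fibre carries the positive weight of the path itself, so the GM side of the dictionary is
nonzero. [folklore] -/
theorem exists_mids_eq {Ω : Set ℂ} {δ : ℝ} {a b : MidEdge} (p : CPath Ω δ a b) :
    ∃ γ : YangBaxterSAW Θ₂ Ω δ a b, γ.mids = ports p.1 := by
  by_contra hne
  push Not at hne
  have h := tsum_fibre_eq hP hsol (meshFaces Θ₂ Ω δ) a b (ports p.1)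
  have h0 : (∑' γ : {γ : YBWalk (meshFaces Θ₂ Ω δ) a b // γ.mids = ports p.1},
      ENNReal.ofReal (γ.1.weight Θ₂)) = 0 := by
    haveI : IsEmpty {γ : YBWalk (meshFaces Θ₂ Ω δ) a b // γ.mids = ports p.1} :=
      ⟨fun γ => hne γ.1 γ.2⟩
    exact tsum_empty
  rw [h0] at h
  have hp : ENNReal.ofReal (compassWt α β s z p.1) ≤
      ∑' q : CFibre (meshFaces Θ₂ Ω δ) a b (ports p.1), ENNReal.ofReal (compassWt α β s z q.1) :=
    ENNReal.le_tsum (⟨p.1, p.2.1, fun v hv => p.2.2 v hv, rfl⟩ : CFibre _ a b (ports p.1))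
  rw [h] at hp
  exact absurd (nonpos_iff_eq_zero.1 hp)
    (ENNReal.ofReal_pos.2 (compassWt_pos hsol.1 hsol.2.1 hsol.2.2.1 hsol.2.2.2.1 p.1)).ne'

/-- **The Yang–Baxter walk of a compass path** (same ports in the same order). [folklore] -/
def toYB {Ω : Set ℂ} {δ : ℝ} {a b : MidEdge} (p : CPath Ω δ a b) : YangBaxterSAW Θ₂ Ω δ a b :=
  (exists_mids_eq hP hsol p).choose

/-- `toYB p` crosses the ports of `p`, in order. [folklore] -/
theorem toYB_mids {Ω : Set ℂ} {δ : ℝ} {a b : MidEdge} (p : CPath Ω δ a b) :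
    (toYB hP hsol p).mids = ports p.1 :=
  (exists_mids_eq hP hsol p).choose_spec

/-- `toYB p = γ` iff `γ` crosses the ports of `p`. [folklore] -/
theorem toYB_eq_iff {Ω : Set ℂ} {δ : ℝ} {a b : MidEdge} (p : CPath Ω δ a b)
    (γ : YangBaxterSAW Θ₂ Ω δ a b) : toYB hP hsol p = γ ↔ ports p.1 = γ.mids :=
  ⟨fun h => h ▸ (toYB_mids hP hsol p).symm, fun h => YBWalk.ext ((toYB_mids hP hsol p).trans h)⟩

/-- **The dictionary as an identity of measures**: pushing `ρ₀ = Σ_p wt(p) δ_p` forward along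
`toYB` gives GM's `ybWeight (π/2) Ω δ 1 a b = Σ_γ w(γ) δ_γ`. [folklore] -/
theorem map_toYB (Ω : Set ℂ) (δ : ℝ) (a b : MidEdge) :
    (compassRho0 α β s z Ω δ a b).map (toYB hP hsol) = ybWeight Θ₂ Ω δ 1 a b := by
  refine Measure.ext fun S _ => ?_
  rw [Measure.map_apply (measurable_cpath _) MeasurableSpace.measurableSet_top, compassRho0,
    Measure.sum_apply _ MeasurableSpace.measurableSet_top, ybWeight,
    Measure.sum_apply _ MeasurableSpace.measurableSet_top]
  simp only [Measure.smul_apply, smul_eq_mul, Measure.dirac_apply' _ MeasurableSpace.measurableSet_top,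
    Real.one_rpow, mul_one]
  rw [← (Equiv.sigmaFiberEquiv (toYB hP hsol)).tsum_eq, ENNReal.tsum_sigma']
  refine tsum_congr fun γ => ?_
  have hind : ∀ q : {p : CPath Ω δ a b // toYB hP hsol p = γ},
      (toYB hP hsol ⁻¹' S).indicator (1 : CPath Ω δ a b → ℝ≥0∞) q.1 = S.indicator 1 γ := by
    rintro ⟨q, hq⟩
    by_cases hS : γ ∈ S
    · rw [Set.indicator_of_mem hS, Set.indicator_of_mem (show q ∈ toYB hP hsol ⁻¹' S by
        rw [Set.mem_preimage, hq]; exact hS)]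
      rfl
    · rw [Set.indicator_of_notMem hS, Set.indicator_of_notMem (show q ∉ toYB hP hsol ⁻¹' S by
        rw [Set.mem_preimage, hq]; exact hS)]
  simp only [Equiv.sigmaFiberEquiv_apply, hind, ENNReal.tsum_mul_right]
  congr 1
  -- the fibre of `toYB` over `γ` is the compass side of the dictionary at `ms = γ.mids`
  let e : CFibre (meshFaces Θ₂ Ω δ) a b γ.mids ≃ {p : CPath Ω δ a b // toYB hP hsol p = γ} :=
    { toFun := fun r => ⟨⟨r.1, r.2.1, fun v hv => r.2.2.1 v hv⟩, (toYB_eq_iff hP hsol _ γ).2 r.2.2.2⟩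
      invFun := fun q => ⟨q.1.1, q.1.2.1, fun v hv => q.1.2.2 v hv, (toYB_eq_iff hP hsol _ γ).1 q.2⟩
      left_inv := fun _ => rfl
      right_inv := fun _ => rfl }
  rw [← e.tsum_eq]
  exact (tsum_fibre_eq hP hsol _ a b γ.mids).trans (tsum_mids_eq γ)

/-- **The partition functions agree**: `Z^{YB}_{Ω_δ}(a, b) = Σ_p wt(p)`. [folklore] -/
theorem ybWeight_univ_eq (Ω : Set ℂ) (δ : ℝ) (a b : MidEdge) :
    ybWeight Θ₂ Ω δ 1 a b Set.univ = compassRho0 α β s z Ω δ a b Set.univ := by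
  rw [← map_toYB hP hsol, Measure.map_apply (measurable_cpath _) MeasurableSet.univ,
    Set.preimage_univ]

/-- **GM's law is the push-forward of the normalised compass path measure along `toYB`.**
[folklore] -/
theorem ybLaw_eq_map (Ω : Set ℂ) (δ : ℝ) (a b : MidEdge) :
    ybLaw Θ₂ Ω δ 1 a b = (compassRho α β s z Ω δ a b).map (toYB hP hsol) := by
  rw [ybLaw, compassRho, Measure.map_smul, map_toYB, ybWeight_univ_eq hP hsol]

end Dictionary

end Summit.CriticalPhenomena.SAWScalingLimit.Cruxes.HexTransfer.Sketch.PortTransfer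

end
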